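import Mathlib
import HarnessLib
import HarnessLib.Audit
import Summits.PneNP.Statement
import Literature.Computability.Complexity.ClayProblem
import Literature.Computability.Complexity.Nondeterministic
import Literature.Computability.Complexity.Classes
import Literature.Computability.Complexity.BoolEncodings
import Literature.Computability.Complexity.ConstantDepth
import Literature.Computability.MetaComplexity.SmolenskyProperty
import Literature.NumberTheory.Sieve.PretentiousDistance
import Literature.Computability.QuantumComplexity.Factoring

/-!
Route: Mobius

"Möbius versus machines" (card PneNP/PneNP/mobius-pretentious-rigidity). It suffices to show X: the
Liouville language L_λ = {bin(n) : λ(n) = +1} = {n ≥ 1 : Ω(n) even} is not decidable in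
deterministic polynomial time — λ(n) = (−1)^Ω(n) is not polynomial-time computable from the binary
digits of n.
Lean (decl LiouvilleNotInP, elaborates): `Computability.encodingNatBool.toLanguage {n : ℕ |
ArithmeticFunction.liouville n = 1} ∉ Literature.Computability.Complexity.Classes.P`.
Since L_λ ∈ NP ∩ coNP (Pratt 1975: the prime factorisation of n with primality certificates is a
succinct witness for either value of λ(n); support item LiouvilleInNP, reusing the tree's Pratt
machine of FactoringProofs.lean), X exhibits a language in NP ∖ P, and PneNP follows through the
PROVED model bridges P_bool_eq_holds / NP_bool_eq_holds (Assembly: P_bool_eq → NP_bool_eq →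
LiouvilleInNP → LiouvilleNotInP → PneNP, propositional, checked in the planner's Sketch.lean).
The line of attack below X is a ladder of circuit classes reading the digits of n — AC⁰ (Green 2012,
a theorem) ⊂ AC⁰[2] ⊂ TC⁰ — climbed by PRETENTIOUS RIGIDITY: an easy completely multiplicative
±1-valued function must pretend to be a Dirichlet character (sum–product: digital and multiplicative
simplicity meet only in characters), while λ is non-pretentious (tree theorem
Literature.NumberTheory.Sieve.isNonpretentious_liouville).

Rationale: ## Why this line (widen: analytic number theory × circuit complexity; card
mobius-pretentious-rigidity)
Fix ONE explicit function in NP ∩ coNP — Liouville's λ read from the binary digits — and climb the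
machine ladder AC⁰ ⊂ AC⁰[2] ⊂ TC⁰ ⊂ … ⊂ P
towards X = "λ ∉ P". Engine = sum–product incompatibility of digital (2-adic/additive) structure
with multiplicativity: the only functions that are
both digitally and multiplicatively simple should be Dirichlet characters (quadratic reciprocity is
what makes Jacobi symbols easy), so an EASY
completely multiplicative ±1 function must be PRETENTIOUS (Granville–Soundararajan distance to some
χ·n^{it} bounded), while λ is non-pretentious
— a PROVED tree fact (isNonpretentious_liouville_holds). Rung 1 is Green2012 (λ ⊥ AC⁰ via LMN, Prop.
1: |λ̂(S)| ≪ k e^{-c√n/k}); degree-1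
digital phases are closed by Bourgain2013MoebiusWalsh (|μ̂(A)| < 2^{-n^{1/10}} for ALL Walsh A) and
Bourgain2013Walsh (level n^{2/3}).
The tree already PROVES the circuit side of rungs 1–2 (Tal2017 Fourier tails
`Circuit.l1Level_acBasis_le`, `PARITY_not_mem_AC0`, the
Razborov–Smolensky lemma `Smolensky.razborov_smolensky` with its lowDeg/CubeFn vocabulary) and the
classical arithmetic inputs
(halaszMontgomeryTenenbaum_holds, SiegelWalfiszMoebius_holds, the pretentious-distance API,
FACT/PRIMES ∈ NP∩coNP machinery, AKS), so every
item is typed over definitions and proved cone facts only — no unproved named fact is load-bearing.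
Imported areas: pretentious multiplicative
number theory (GS, Halász, MRT, Tao2016), digital exponential sums (MauduitRivat2015, Bourgain),
Fourier analysis of AC⁰ (LinialMansourNisan1993,
Hastad2014, Tal2017), the polynomial method (Smolensky1987), the Kátai–BSZ bilinear criterion
(BourgainSarnakZiegler2013). Catalogue: "bring
another area to bear" = analytic number theory on an explicit NP∩coNP function; no physical analogy;
no new object posited.
## Ranked cruxes (all elaborate; Sketch.lean rc 0)
#2 LiouvilleDigitalPhases — λ has o(2^m) correlation with every 𝔽₂-polynomial phase of degree ≤
(log₂ m)^c in the m binary digits (Green's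
question beyond Walsh characters; exactly the input Razborov–Smolensky needs) ⇒ rung 2
LiouvilleNotAC0Mod2 via the proved RS lemma (glue item
DigitalPhasesGlue). Hardest and most informative; first child when split: degree-2 (quadratic)
digital phases, open for non-automatic forms.
#3 AC0MultiplicativePretentious — RIGIDITY/classification: a completely multiplicative f : ℕ →* ℤ
with f(p) = ±1 whose language {n : f n = 1}
is in AC⁰ is not non-pretentious; with isNonpretentious_liouville it re-proves Green (glue
PretentiousGlue → LiouvilleNotAC0). Lifts
Klurman–Kurlberg (arXiv:1904.04337) / KoniecznyLemanczykMullner2021 from automata to AC⁰; the first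
deliverable theorem of the line.
#4 LiouvilleNotTC0 — the (non-uniform) TC⁰ rung; beyond known technique, formally non-natural
(multiplicativity is a non-large property).
#5 LiouvilleInP = ¬X, staffed as kill switch (an algorithm for Ω(n) mod 2 that does not factor;
AdlemanMcCurley1994 list it open).
Support (rank 9): LiouvilleInNP (assembly input), LiouvilleNotAC0 (Green's theorem = rung 1,
formalisable now: Tal + Green Prop. 1),
LiouvilleNotAC0Mod2 (rung-2 milestone), the two glues, ImpliesFactoringNotInP (X ⇒ ¬FactInP: honesty
item — the thesis is at least as strong
as factoring hardness; links the QuantumAdvantage/factoring cone).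
## Assembly and logical shape
P_bool_eq → NP_bool_eq → LiouvilleInNP → LiouvilleNotInP → PneNP (propositional). Rungs #2–#4 are
NON-UNIFORM constant-depth statements:
the informative bits of the line, logically independent of the uniform statement X (two layers:
cruxes now, glue/splits after a crux closes).
## Kill criteria
LiouvilleInP proved ⇒ route closed refuted:LiouvilleNotInP. AC0MultiplicativePretentious refuted (a
non-pretentious completely multiplicative
±1 function inside AC⁰) ⇒ the rigidity ENGINE is dead: close unless #2 survives as a pure
correlation programme (re-rank). LiouvilleDigitalPhases
refuted (λ correlates with a polylog-degree digital phase, i.e. with quasi-polynomial depth-3 parity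
circuits) would itself be a sensation
against Möbius randomness: record as negative knowledge and close the circuit ladder.
## Deliberately NOT decomposed yet
Quadratic digital phases (child of #2); the exact form of #3 (f(n) = ε^{v₂(n)} χ(odd part of n), χ
real mod 8) and its robust 1−ε version;
ACC⁰ with composite moduli (CompositeModulusDegree applies); uniform rungs (L, NL); "λ ∈ FP ⇒
FACTORING ∈ FP?" (open); Green's 2-power-modulus
PNT (q = 2^t ≤ e^{c√log N}, Montgomery–Vaughan Ex. 11.3.7) and Vaughan/Davenport minor arcs for μ
are KNOWN inputs provers may need as lemmas
(tree has Siegel–Walfisz only for q ≤ (log x)^A).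
Sources: Green2012 (=arXiv:1103.4991); Bourgain2013Walsh; Bourgain2013MoebiusWalsh;
doi:10.1007/s11854-016-0012-1; MauduitRivat2015;
Mullner2017; KoniecznyLemanczykMullner2021; arXiv:1904.04337; Tal2017; Smolensky1987;
LinialMansourNisan1993; Hastad2014;
BourgainSarnakZiegler2013; GranvilleSoundararajan2007; MatomakiRadziwillTao2015; Tao2016;
NaorReingold2004; HesseAllenderBarrington2002;
RazborovRudich1997; AdlemanMcCurley1994; Pratt1975; AgrawalKayalSaxena2004.

Novelty: Search-before-claim (2026-08-15, this session): lit read arXiv:1103.4991 pp.3–4 (Green: Thm 1, Prop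
1, the 'all S'/|S| > n^{1/2} question, LMN step) and arXiv:1112.1423 p.1 (Bourgain: Thm 1 level
n^{2/3}; quotes [B1] (1.4): |μ̂(A)| < 2^{-n^{1/10}} for ALL Walsh A; Cor 2 monotone functions); lit
search crossref "Fourier-Walsh spectrum Moebius function" (finds part II
doi:10.1007/s11854-016-0012-1, nothing later on circuits) and "Möbius function Walsh digital
polynomial circuits multiplicative automatic" (noise: 'multiplicative functions resembling Möbius',
unrelated); lit galaxy search --star all "Liouville function polynomial time" (0 rows) and "parity
of the number of prime factors" (7 panama rows, none relevant); lit vsearch ×2 (held books only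
generic Walsh analysis: arora2009 p.456, jukna2012 pp.356–357); searchd local index rc 75 / reset
(unavailable), OpenAlex 429, zbMATH 0 rows. Plus the card's own searches (crossref ×7, galaxy,
frontier/bridges PneNP: no number-theoretic descendant) and the second-opinion audit
refuter-novelty-audit-PneNP-PneNP-14-0 (zbMATH ×3, crossref, galaxy ×3), grade new-combination
CONFIRMED.
Nearest prior art FOUND: Green2012 = arXiv:1103.4991 (μ, λ ⊥ AC⁰ via LMN — rung 1 is KNOWN and filed
as support, not crux); Bourgain2013MoebiusWalsh + Bourgain2013Walsh + doi:10.1007/s11854-016-0012-1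
(all degree-1 digital phases = Walsh characters; level n^{2/3}; monotone Boolean functions);
MauduitRivat2015 and Mullner2017 (Rudin–Shapiro / all AUTOMATIC s  [refs: 10.1007/s11854-016-0012-1, 10.1006/jcss.2000.1725, 10.1006/inco.2000.3017, 10.1007/978-3-0348-8037-4, 1103.4991, 1112.1423, 1904.04337, doi:10.1007/s11854-016-0012-1, doi:10.1006/jcss.2000.1725, doi:10.1006/inco.2000.3017, doi:10.1007/978-3-0348-8037-4, Green2012, MauduitRivat2015, Mullner2017, KoniecznyLemanczykMullner2021, AdlemanMcCurley1994, Tal2017]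

Barriers (technique_class: AC0-lower-bounds, acc0-lower-bounds, tc0-lower-bounds): - Literature.Barriers.PneNP.NaturalProofs: the property the rigidity cruxes use — 'completely
multiplicative ∧ non-pretentious' — is P-constructive from the truth table but has density ≤
2^{π(2^m) − 2^m} among m-bit truth tables, NOT large, so the Razborov–Rudich hypothesis fails
formally for AC0MultiplicativePretentious and LiouvilleNotTC0; the rung-1/2 items (LiouvilleNotAC0,
DigitalPhasesGlue) do use natural arguments (Tal/LMN tails, Razborov–Smolensky) but below TC⁰, where
no pseudorandom function family lives — harmless there.
- Literature.Barriers.PneNP.NaturalProofsTC0: APPLIES to crux LiouvilleNotTC0 for large constructive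
properties (Naor–Reingold PRFs in TC⁰); evaded only formally (non-large property 'multiplicative');
honestly no technique is known — the bet is a Halász-type arithmetic argument (multiplicativity +
bounded pretentious distance force character-like structure) that never inspects the circuit; noted
that the NR PRFs are themselves built from DDH/factoring, the same arithmetic that should make λ
hard.
- Literature.Barriers.PneNP.NaturalProofsTC0OfSubexpDDH: same item, same answer; the route's
statements concern only completely multiplicative functions and yield no distinguisher for the
Naor–Reingold family, so a proof of LiouvilleNotTC0 along this line would not contradict
subexponential DDH.
- Literature.Barriers.PneNP.Locality: the AC⁰-level items (support LiouvilleNotAC0, circuit side of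
AC0MultiplicativePretentious) consume switching-lemma/LMN/Tal f

Novelty grade: new-combination — ROUTE REVIEW (refuter 40af5994, 2026-08-15). ITEMS: all 12 elaborate (my probe V_pnp.lean rc0 concurs with the ≥6 pool refuters and ≥12 grounders who swarmed this route 10:55–11:12Z; 1115/1117 have sorry-free candidate proofs on file; 1112 = Green2012 = fact p39525); cruxes 1107/1108/1109 precise, n (refuter refuter-rreview-route-HubbardSuperconduc-40af5994-0, 2026-08-15T11:18:23Z; prior: arXiv:1103.4991 (Green2012 Thm 1 + Prop 1: λ,μ ⊥ AC⁰; AC⁰[2]/polynomial-phase question open), arXiv:1112.1423 + doi:10.1007/s11854-016-0012-1 (Bourgain: all Walsh characters, level n^{2/3}), arXiv:1904.04337 (Klurman–Kurlberg) + KoniecznyLemanczykMullner2021 (multiplicative AUTOMATIC sequences classified), MauduitRivat2015 / Mullner2017 (Rudin–Shapiro / automatic digital phases), AdlemanMcCurley19)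

sub-problem: PneNP · status: done · opened planner-plancard-PneNP-PneNP-mobius-pretentio-b8c3de6f-0 2026-08-15T10:51:02Z · rev 2 · ledger route-PneNP-Mobius
GENERATED by the gate from the ledger (D-0016/17). Provers cite these decls: `theorem foo : Summit.PneNP.PneNP.Theses.Mobius.<Decl> := …` in Summits/PneNP/PneNP/Theorems/<Name>.lean.
-/

namespace Summit.PneNP.PneNP.Theses.Mobius

open scoped BigOperators Topology Manifold Classical MeasureTheory ProbabilityTheory Matrix InnerProductSpace ComplexConjugate ContinuousMap
open Filter Set Function TopologicalSpace MeasureTheory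

attribute [summit_statement] _root_.PneNP

open Literature.PNP

/-- item stmt-PneNP-1106 · target · rank 0 · open · by planner
why it might fail: No technique separates any explicit NP∩coNP language from uniform P; X ⇒ ¬FactInP, so X carries all of factoring hardness plus the bet that Ω(n) mod 2 has no factoring-free algorithm — reciprocity makes Jacobi symbols easy and squarefreeness may be decidable without factoring (BHK 2015).
sources: AdlemanMcCurley1994, Pratt1975, Literature.Computability.QuantumComplexity.FactInP, arXiv:1103.4991 (Green 2012, p.3: 'the difficulty of computing number theoretic functions'), doi:10.1215/00127094-2856619 (Booker–Hiary–Keating 2015: squarefreeness without factoring)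
[target] X: the Liouville language L_λ = {bin(n) : λ(n)=+1} = {n ≥ 1 : Ω(n) even} (canonical binary
numerals, Mathlib encodingNatBool) is not in P — 'λ is not polynomial-time computable'. With
LiouvilleInNP (Pratt) it gives PneNP (Assembly). Stronger than ¬FactInP (ImpliesFactoringNotInP): λ
is read off the factorisation. [card mobius-pretentious-rigidity; AdlemanMcCurley1994 list μ/λ vs
factoring as open] -/
@[route_item "route-PneNP-Mobius"]
def LiouvilleNotInP : Prop :=
  Computability.encodingNatBool.toLanguage {n : ℕ | ArithmeticFunction.liouville n = 1} ∉ Literature.Computability.Complexity.Classes.P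

/-- item stmt-PneNP-1107 · crux · rank 2 · open · by planner
why it might fail: Open already at degree 2: digital Type I/II methods (Mauduit–Rivat, Müllner, Hanna) need carry-locality or automaticity, which a generic m-dependent form Σ a_ij x_i x_j lacks; polylog degree needs a new bilinear engine along pn, qn; beyond degree 1 (Bourgain) nothing excludes a correlating phase.
sources: Green2012 (arXiv:1103.4991 p.3: Prop. 1 and the question for all S), Bourgain2013MoebiusWalsh, Bourgain2013Walsh (arXiv:1112.1423 Thm 1), MauduitRivat2015, Mullner2017, doi:10.4064/aa8337-8-2016 (Hanna 2017: block-occurrence phases = local digital polynomials of fixed degree)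
[crux] λ is orthogonal to every low-degree 𝔽₂-POLYNOMIAL PHASE of the binary digits: for each c and
ε > 0, for all large m and every P : {0,1}^m → 𝔽₂ of degree ≤ (log₂ m)^c (tree: Smolensky.lowDeg),
|Σ_{x ∈ {0,1}^m} λ(val x)·(−1)^{P(x)}| ≤ ε·2^m (val = bitsToNat ∘ List.ofFn, λ(0) = 0). Degree 1 =
Walsh characters is Bourgain2013MoebiusWalsh (|μ̂(A)| < 2^{-m^{1/10}} for all A) after Green2012
Prop. 1 (|S| ≤ m^{1/2−η}); automatic degree-2 phases (Rudin–Shapiro) are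
MauduitRivat2015/Mullner2017; generic quadratic forms in the digits are already open. This is
exactly the input the PROVED Razborov–Smolensky lemma
(Literature.Computability.MetaComplexity.Smolensky.razborov_smolensky, degree ((p−1)ℓ)^depth, error
≤ size·2^m/2^ℓ) needs for rung 2: glue DigitalPhasesGlue ⇒ LiouvilleNotAC0Mod2. Engine expected:
Type I (λ in APs mod 2^t, t ≤ c√m — Green's 2-power PNT, M–V Ex. 11.3.7; tree has Siegel–Walfisz for
q ≤ (log x)^A, SiegelWalfiszMoebius_holds) + Type II / Kátai–BSZ bilinear sums of digital phases
along n ↦ pn, qn (carry analysis à la Mauduit–Rivat). First split child if needed: quadratic phases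
(degree 2). -/
@[route_item "route-PneNP-Mobius"]
def LiouvilleDigitalPhases : Prop :=
  ∀ c : ℕ, ∀ ε : ℝ, 0 < ε → ∃ M : ℕ, ∀ m ≥ M, ∀ P : Literature.Computability.MetaComplexity.Smolensky.CubeFn (ZMod 2) m, P ∈ Literature.Computability.MetaComplexity.Smolensky.lowDeg (ZMod 2) m (Nat.log 2 m ^ c) → |∑ x : Fin m → Bool, (ArithmeticFunction.liouville (Literature.Computability.Complexity.bitsToNat (List.ofFn x)) : ℝ) * (if P x = 0 then (1 : ℝ) else -1)| ≤ ε * 2 ^ m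

/-- item stmt-PneNP-1108 · crux · rank 3 · open · by planner
why it might fail: Only the AUTOMATIC analogue is known (Lemańczyk–Müllner 2020; KK/KLM/Li); AC⁰ is incomparable with automatic. Needs the unprinted digital bilinear bound Σ_n w_S(pn)w_S(qn)=o(2^m) and, for general f, Halász/MR input in place of Green's PNT mod 2^t; an adversarial scale-by-scale f may refute it.
sources: doi:10.3934/dcds.2020260 (Lemańczyk–Müllner 2020: automatic sequences ⊥ aperiodic multiplicative functions), arXiv:1904.04337 (Klurman–Kurlberg), KoniecznyLemanczykMullner2021, doi:10.1016/j.jnt.2019.12.015 (Li 2020: completely multiplicative automatic sequences), BourgainSarnakZiegler2013 (Kátai criterion, Thm 2), Tal2017 (tree: Literature.Computability.Complexity.Circuit.l1Level_acBasis_le, proved)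
[crux] PRETENTIOUS RIGIDITY in AC⁰ (classification): every completely multiplicative f : ℕ →* ℤ with
f(p) ∈ {1, −1} at all primes whose language {bin(n) : f(n) = 1} is decided by a constant-depth
polynomial-size ∧/∨/¬ circuit family is NOT non-pretentious (tree: ¬
Literature.NumberTheory.Sieve.IsNonpretentious (f : ℕ → ℂ)), i.e. it pretends to some twisted
character χ(n)n^{it} along a sequence of scales (for ±1-valued f necessarily t = 0, χ real;
conjecturally exactly f(n) = ε^{v₂(n)} χ(n/2^{v₂(n)}) with χ real mod 8). Lifts the
automatic-sequence classification (Klurman–Kurlberg arXiv:1904.04337; KoniecznyLemanczykMullner2021)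
to AC⁰; together with the PROVED isNonpretentious_liouville_holds it re-proves Green's theorem (glue
PretentiousGlue → LiouvilleNotAC0). Expected proof: Tal's proved L1 tail bound
Circuit.l1Level_acBasis_le reduces to low-weight Walsh functions w_S; periodic part (low digits) by
Halász in progressions mod 2^k (halaszMontgomeryTenenbaum_holds applied to f·χ̄); non-periodic part
(high/middle digits) by the Kátai–Bourgain–Sarnak–Ziegler criterion, which needs the digital
bilinear estimate Σ_n w_S(pn) w_S(qn) = o(2^m) for distinct odd primes p, q. First delivera -/
@[route_item "route-PneNP-Mobius"]
def AC0MultiplicativePretentious : Prop :=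
  ∀ f : ℕ →* ℤ, (∀ p : ℕ, p.Prime → f p = 1 ∨ f p = -1) → Computability.encodingNatBool.toLanguage {n : ℕ | f n = 1} ∈ Literature.Computability.Complexity.AC0 → ¬ Literature.NumberTheory.Sieve.IsNonpretentious (fun n => (f n : ℂ))

/-- item stmt-PneNP-1109 · crux · rank 4 · open · by planner
why it might fail: Implies NP ⊄ TC⁰/poly (L_λ ∈ NP), open even for NEXP (best: NQP ⊄ ACC⁰; depth-2 threshold only ~n^{3/2} gates); Naor–Reingold PRFs sit in TC⁰, so only the non-large property 'multiplicative' is usable and no technique exploits it; λ on m^O(1)-smooth inputs IS in TC⁰ (division, HAB).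
sources: NaorReingold2004, Literature.Barriers.PneNP.NaturalProofsTC0, RazborovRudich1997 (Literature.Barriers.PneNP.NaturalProofs), HesseAllenderBarrington2002, MurrayWilliams2018 (NQP ⊄ ACC⁰: frontier below TC⁰), KaneWilliams2016 (depth-2/3 threshold-circuit lower bounds)
[crux] The TC⁰ rung: L_λ is decided by no constant-depth polynomial-size family of ∧/∨/¬/MAJORITY
circuits (non-uniform; tree class Literature.Computability.Complexity.TC0). Formally outside
Razborov–Rudich (the usable property 'completely multiplicative ∧ non-pretentious' is non-large) but
any proof must coexist with the Naor–Reingold PRFs in TC⁰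
(Literature.Barriers.PneNP.NaturalProofsTC0) — themselves built from DDH/factoring. Note TC⁰
computes division and iterated products (HesseAllenderBarrington2002), hence v_p(n) for all p ≤
polylog and λ on polylog-smooth inputs: a proof must live on integers with large prime factors.
Logically independent of X (non-uniform class). -/
@[route_item "route-PneNP-Mobius"]
def LiouvilleNotTC0 : Prop :=
  Computability.encodingNatBool.toLanguage {n : ℕ | ArithmeticFunction.liouville n = 1} ∉ Literature.Computability.Complexity.TC0

/-- item stmt-PneNP-1110 · crux · rank 5 · open · by planner
why it might fail: Expected FALSE (¬X, kill switch): every known algorithm for λ(n) factors n; μ/λ/squarefreeness vs factoring listed open (Adleman–McCurley). Needs a factoring-free evaluation of Ω(n) mod 2 — reciprocity gives that only for Jacobi symbols, BHK's L-function method only squarefreeness; refuting it = X.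
sources: AdlemanMcCurley1994, AgrawalKayalSaxena2004 (tree: PRIMES_mem_P), doi:10.1215/00127094-2856619 (Booker–Hiary–Keating 2015), Literature.Computability.QuantumComplexity.FactInP
[crux] NEGATIVE SIDE ¬X, staffed as kill switch: L_λ ∈ P — a deterministic polynomial-time algorithm
for Ω(n) mod 2. Proved ⇒ route closed (refuted:LiouvilleNotInP) and a famous open problem of
AdlemanMcCurley1994 settled; the natural attack is a factoring-free evaluation of a multiplicative
function (as reciprocity gives for Jacobi symbols), the natural obstruction a reduction FACTORING ≤
λ-oracle (unknown either way). -/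
@[route_item "route-PneNP-Mobius"]
def LiouvilleInP : Prop :=
  Computability.encodingNatBool.toLanguage {n : ℕ | ArithmeticFunction.liouville n = 1} ∈ Literature.Computability.Complexity.Classes.P

/-- item stmt-PneNP-1111 · support · rank 9 · closed · proved by Summit.PneNP.PneNP.Theorems.mobius_liouvilleInNP_proof @ fe5716524ea4 (prover) · by planner
sources: Pratt1975, Literature.Computability.QuantumComplexity.FACT_mem_NP_inter_coNP_holds (FactoringProofs.lean: the Pratt machine to adapt)
[support] L_λ ∈ NP (Pratt 1975; folklore 'λ ∈ NP ∩ coNP'): certificate for bin(n) = the prime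
factorisation p₁…p_k of n (with multiplicity) plus Pratt certificates; the verifier checks Π pᵢ = n,
every pᵢ certified prime, k even. Routine in print; in Lean reuse FactoringProofs.lean (factCert,
certTestFn, prodListFn, allFn, Pratt.CertValid, length bounds length_factCert_le) and add a
parity-of-list-length brick. Needed by the Assembly. The coNP half is symmetric (k odd) and not
filed. -/
@[route_item "route-PneNP-Mobius"]
def LiouvilleInNP : Prop :=
  Computability.encodingNatBool.toLanguage {n : ℕ | ArithmeticFunction.liouville n = 1} ∈ Literature.Computability.Complexity.Nondeterministic.NP

/-- item stmt-PneNP-1112 · support · rank 9 · closed · proved by Summit.PneNP.PneNP.Theorems.mobius_liouvilleNotAC0_proof @ 834dac991440 (prover) · by planner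
sources: Green2012 (arXiv:1103.4991 Thm 1, Prop 1, §2), Tal2017 (tree, proved), LinialMansourNisan1993
[support] Rung 1 = Green's theorem (KNOWN, Green2012 Thm 1, 'all results hold equally for λ'): L_λ ∉
AC⁰. Formalisable now: circuit side = Tal's PROVED bounds (Circuit.l1Level_acBasis_le:
Σ_{|S|=k}|F̂(S)| ≤ (c ln s)^{(d−1)k}, plus the L2 tail tailWeight_le_tailBound) in place of LMN;
arithmetic side = Green's Prop. 1 |λ̂(S)| ≪ k·e^{−c√m/k} (Kátai-type Prop. 2, major arcs = PNT for λ
twisted by characters mod 2^t, t ≤ c√m — no Siegel zero for 2-power moduli —, minor arcs =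
Vaughan/Davenport Ch. 25, Harman–Kátai observation); take k ≤ m^{1/5}. Also follows from either glue
(PretentiousGlue, or DigitalPhasesGlue + AC0 ⊆ AC0Mod 2). Mind the encoding: length-m inputs are the
integers in [2^{m−1}, 2^m) (top bit 1) plus non-codewords. -/
@[route_item "route-PneNP-Mobius"]
def LiouvilleNotAC0 : Prop :=
  Computability.encodingNatBool.toLanguage {n : ℕ | ArithmeticFunction.liouville n = 1} ∉ Literature.Computability.Complexity.AC0

/-- item stmt-PneNP-1113 · support · rank 9 · open · by planner
sources: Smolensky1987 (tree: Smolensky.razborov_smolensky), Green2012 p.3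
[support] Rung-2 milestone: L_λ ∉ AC⁰[2] (constant depth, polynomial size, ∧/∨/¬/PARITY gates; tree
class AC0Mod 2). The intended proof is DigitalPhasesGlue from crux LiouvilleDigitalPhases via the
proved Razborov–Smolensky lemma; filed separately so that any other proof closes the rung and so
that AC0 ⊆ AC0Mod 2 (tree: AC0_subset_AC0Mod) transfers it down to LiouvilleNotAC0. -/
@[route_item "route-PneNP-Mobius"]
def LiouvilleNotAC0Mod2 : Prop :=
  Computability.encodingNatBool.toLanguage {n : ℕ | ArithmeticFunction.liouville n = 1} ∉ Literature.Computability.Complexity.AC0Mod 2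

/-- item stmt-PneNP-1114 · support · rank 9 · closed · proved by Summit.PneNP.PneNP.Theorems.mobius_digitalPhasesGlue_proof @ 61dc0011ca86 (prover) · by planner
sources: Smolensky1987 (tree: Literature.Computability.MetaComplexity.Smolensky.razborov_smolensky, proved), Literature.NumberTheory.LFunctions.SiegelWalfiszMoebius.liouville_progression (proved)
[support] Glue for rung 2: LiouvilleDigitalPhases → LiouvilleNotAC0Mod2. Given a depth-d size-q(m)
accBasis-2 family deciding L_λ, apply Smolensky.razborov_smolensky with ℓ ≈ C·log₂ m: a cube
function P ∈ lowDeg (ZMod 2) m (ℓ^d) ⊆ lowDeg (log₂ m)^{d+1} agreeing with the circuit off a set E,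
|E| ≤ q(m)·2^m/2^ℓ ≤ 2^m/16; the circuit's ±1 output equals λ(val x) on codewords (top bit 1, val x
≥ 2^{m−1}) — half the cube — so |Σ λ(val x)(−1)^{P(x)}| ≥ 2^{m−1} − |Σ_{n<2^{m−1}} λ(n)| − 2|E|,
contradicting the crux at ε = 1/8 once Σ_{n<x} λ(n) = o(x) (tree: Siegel–Walfisz/PNT for λ, q = 1) —
or avoid PNT by recursing on the leading-zero count with the families at smaller lengths (degree
+O(log m)). Provable now modulo bookkeeping (CircuitFamily.Decides ↔ cube functions via List.ofFn). -/
@[route_item "route-PneNP-Mobius"]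
def DigitalPhasesGlue : Prop :=
  LiouvilleDigitalPhases → LiouvilleNotAC0Mod2

/-- item stmt-PneNP-1115 · support · rank 9 · closed · proved by Summit.PneNP.PneNP.Theorems.mobius_pretentiousGlue_proof @ e6e6955a64b4 (prover) · by planner
sources: Literature.NumberTheory.Sieve.isNonpretentious_liouville (proved: isNonpretentious_liouville_holds), Green2012
[support] Glue: AC0MultiplicativePretentious → LiouvilleNotAC0. λ is a monoid hom ℕ →* ℤ
(ArithmeticFunction.liouville_apply_one/_apply_mul, total) with λ(p) = −1, its language is L_λ, and
(n ↦ (λ n : ℂ)) IS non-pretentious by the PROVED tree theorem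
Literature.NumberTheory.LFunctions.isNonpretentious_liouville_holds
(Literature.NumberTheory.Sieve.isNonpretentious_liouville); so rigidity in AC⁰ re-proves Green's
theorem. Provable now (definitional bookkeeping). -/
@[route_item "route-PneNP-Mobius"]
def PretentiousGlue : Prop :=
  AC0MultiplicativePretentious → LiouvilleNotAC0

/-- item stmt-PneNP-1116 · support · rank 9 · closed · proved by Summit.PneNP.PneNP.Theorems.mobius_impliesFactoringNotInP_proof @ c488d4355f90 (prover) · by planner
sources: Literature.Computability.QuantumComplexity.FactInP, AroraBarakCC2009 Example 2.3
[support] Honesty/bookkeeping item linking the factoring cone: LiouvilleNotInP → ¬FactInP (tree: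
Literature.Computability.QuantumComplexity.FactInP = FACT ∈ P, the bounded-divisor language).
Contrapositive: FACT ∈ P ⇒ (binary search, search-to-decision with TM2 composition) the full prime
factorisation is an FP function ⇒ Ω(n) mod 2 ∈ P. Shows the thesis is AT LEAST as strong as the
factoring assumption of cryptography. Routine in print, laborious in Lean (poly-time Turing
reductions / FP closure under polynomially many oracle calls; cf.
Complexity/CookReducibilityTransitive). -/
@[route_item "route-PneNP-Mobius"]
def ImpliesFactoringNotInP : Prop :=
  LiouvilleNotInP → ¬ Literature.Computability.QuantumComplexity.FactInP

/-- item stmt-PneNP-1117 · assembly · rank 1 · closed · proved by Summit.PneNP.PneNP.Theorems.mobius_assembly_proof @ 16fd1ad49044 (prover) · by planner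
sources: Literature.Computability.Complexity.P_bool_eq_holds, Literature.Computability.Complexity.NP_bool_eq_holds
[assembly] P_bool_eq → NP_bool_eq → LiouvilleInNP → LiouvilleNotInP → PneNP: rewrite Cook's classes
PNPWave0.P/NP Bool into Classes.P / Nondeterministic.NP by the two bridges (both PROVED:
P_bool_eq_holds, NP_bool_eq_holds) and exhibit L_λ. Propositional; checked by `example` in the
planner's Sketch.lean. The ladder cruxes #2–#4 are informative rungs, not assembly inputs. -/
@[route_item "route-PneNP-Mobius"]
def Assembly : Prop :=
  Literature.Computability.Complexity.P_bool_eq → Literature.Computability.Complexity.NP_bool_eq → LiouvilleInNP → LiouvilleNotInP → PneNP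

end Summit.PneNP.PneNP.Theses.Mobius
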